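import Literature.Probability.Percolation.SepArmsOnQuasiMult
import HarnessLib

/-!
# The four-arm separation hypothesis of the tree is the `(4, BWBW)` instance of `sepArmsOn`

Topic: Probability / Percolation; family `crit-perc` (critical site percolation `P = P_{1/2}` on the
triangular lattice `𝕋`; the order-free arm probabilities `polyArmProb κ n N` of `ArmEvents.lean`).
A bookkeeping companion of `SepArmsOnQuasiMult.lean` toward the named fact
`Literature.Probability.Percolation.Nolin2008_prop17_quasiMult` (P. Nolin, *Near-critical percolation
in two dimensions*, EJP 13 (2008), §4.5 Prop. 17 [arXiv 0711.4948: Prop. 16]). The tree states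
Nolin's arm-separation theorem (Thm. 11 [arXiv Thm. 10]) for four alternating arms as the displayed
hypothesis `c · π₄(n, N) ≤ P_{1/2}(sepFourArm n N)` of `critFourArmProb_quasiMult_of_separation`
(`ArmSeparationFourArmProofs.lean`; `sepFourArm` = open arms on sides `0, 3`, closed arms on sides
`1, 4`, `ArmSeparationFourArm.lean`; discharged near-critically for the cluster-form alternating event
in `ArmSeparationNearCriticalFour.lean`). Here:

* `sepFourArm_subset_sepArmsOn` — `sepFourArm n N ⊆ sepArmsOn (T,F,T,F) (0,1,3,4) n N` (the carriers
  of the two open arms, resp. of the two closed arms, are the disjoint pairs of `sepArmPair`);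
* `polyArmProb_quasiMult_four_of_sepFourArm_separation` — hence the tree's four-arm separation
  hypothesis gives the clause of `Nolin2008_prop17_quasiMult` for `κ = (T,F,T,F)` through the generic
  pipeline `polyArmProb_quasiMult_of_sepArmsOn_separation` (radii `n₀ ≤ n₁ < n₂ < n₃`, the shape of
  the named fact, complementing the shape `16 r < 4R < S` of `critFourArmProb_quasiMult_of_separation`).

Everything here is PROVED; no definition and no named fact is introduced.

## References

* P. Nolin, *Near-critical percolation in two dimensions*, Electron. J. Probab. 13 (2008),
  1562–1623, §4.3 Thm. 11, §4.5 Prop. 17 [arXiv 0711.4948: Thm. 10, Prop. 16]. [Nolin2008]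

Tree: `sepFourArm`, `sepArmPair`, `sepArmAt` (`ArmSeparationFourArm.lean`); `critFourArmProb`
(`KestenScaling.lean`); `sepArmsOn` (`SepArmsOnGlue.lean`); `polyArmProb_quasiMult_of_sepArmsOn_separation`
(`SepArmsOnQuasiMult.lean`).
-/

noncomputable section

open MeasureTheory Set

namespace Literature.Probability.Percolation

open LatticeModels

/-- **The tree's well-separated four-arm event inside the generic one**:
`sepFourArm n N ⊆ sepArmsOn (T,F,T,F) (0,1,3,4) n N` — arm `0` (open) on side `0`, arm `1` (closed) on
side `1`, arm `2` (open) on side `3`, arm `3` (closed) on side `4`, with the carriers of `sepArmPair`. [cite: Nolin2008, §4.2, well-separated arm events with landing areas (arXiv 0711.4948: Def. 6–8)] -/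
theorem sepFourArm_subset_sepArmsOn (n N : ℕ) :
    sepFourArm n N ⊆ sepArmsOn ![true, false, true, false] ![0, 1, 3, 4] n N := by
  rintro ω ⟨⟨X, Y, hXY, hA0, hA3⟩, ⟨X', Y', hXY', hA1, hA4⟩⟩
  refine ⟨![X, X', Y, Y'], fun i j hij hκ => ?_, fun j => ?_⟩
  · fin_cases i <;> fin_cases j
    all_goals first
      | exact absurd rfl hij
      | exact absurd hκ (by decide)
      | exact hXY
      | exact hXY.symm
      | exact hXY'
      | exact hXY'.symm
  · fin_cases j
    · exact hA0
    · exact hA1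
    · exact hA3
    · exact hA4

/-- **The clause of `Nolin2008_prop17_quasiMult` for four alternating-listed arms from the tree's
four-arm separation hypothesis** (Nolin 2008, Prop. 17 with Thm. 11 [arXiv 0711.4948: Prop. 16,
Thm. 10]): IF `c · π₄(n, N) ≤ P_{1/2}(sepFourArm n N)` for `n₀ ≤ n`, `2n ≤ N` (the hypothesis of
`critFourArmProb_quasiMult_of_separation`), THEN
`∃ c > 0, ∃ n₀, ∀ n₀ ≤ n₁ < n₂ < n₃, c · π₄(n₁,n₂) π₄(n₂,n₃) ≤ π₄(n₁,n₃)`,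
`π₄ = polyArmProb (T,F,T,F) = critFourArmProb`. [cite: Nolin2008, §4.5 Prop. 17 with §4.3 Thm. 11 (arXiv 0711.4948: Prop. 16, Thm. 10)] -/
theorem polyArmProb_quasiMult_four_of_sepFourArm_separation
    (hsep : ∃ c : ℝ, 0 < c ∧ ∃ n₀ : ℕ, ∀ n N : ℕ, n₀ ≤ n → 2 * n ≤ N →
      c * critFourArmProb n N ≤ (triSitePercolation half).real (sepFourArm n N)) :
    ∃ c : ℝ, 0 < c ∧ ∃ n₀ : ℕ, ∀ n₁ n₂ n₃ : ℕ, n₀ ≤ n₁ → n₁ < n₂ → n₂ < n₃ →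
      c * (polyArmProb ![true, false, true, false] n₁ n₂ * polyArmProb ![true, false, true, false] n₂ n₃) ≤
        polyArmProb ![true, false, true, false] n₁ n₃ := by
  refine polyArmProb_quasiMult_of_sepArmsOn_separation _ ![0, 1, 3, 4] (by decide) ?_
  obtain ⟨c, hc, n₀, h⟩ := hsep
  exact ⟨c, hc, n₀, fun n N hn hN => (h n N hn hN).trans
    (measureReal_mono (sepFourArm_subset_sepArmsOn n N) (measure_ne_top _ _))⟩

end Literature.Probability.Percolation

end
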